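import Literature.Analysis.FluidPDE.FluidComputer.ThresholdLevelStep
import Literature.Analysis.FluidPDE.FluidComputer.DyadicInterval
import HarnessLib

/-!
# Fluid computer blueprint — threshold gate: INTERVAL ENCLOSURES of one refinement pass

HONEST FRAMING: low prior, high value-of-information experiment on Tao's machine paradigm; NOT a
claim that NS blows up. Elementary bookkeeping for the 5-mode circuit `thresholdCircuit ε σ ν μ r κ`
(`ThresholdGate.lean`); nothing is asserted about any fluid equation.

## What this file is (bp3 gen 12 → 13, layer 2 of the R6′ plan)
The dyadic-interval TWINS of the real-valued closed forms of `ThresholdLevelPass.lean` — the rates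
`gℓ gh ρℓ ρh Ψℓ Ψh frc skew sℓ sh Λh Λℓ mℓ mh βℓ βh ζℓ ζh`, Mathlib's `gronwallBound` on its
`K < 0` branch, the envelopes `aFloor aCeil wFloor wCeil`, and the refinement map
`WindowBox.refine`, and (from `ThresholdLevelStep.lean`) the crude pass-1 box `LevelEntry.crudeBox`
with its side conditions — each a structurally identical expression over `DI` (`DyadicInterval.lean`)
together with its SOUNDNESS lemma: if the gate data, the box, the entry box and `h, C, C'` lie in
the given intervals, the real quantity lies in the computed interval.  The runtime side conditions
(positivity of divisors, negativity of the Grönwall rates, nonpositivity of the exponents) are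
collected in the Boolean `refineOK`, which the kernel evaluates; `WindowBoxI.Mem.refine` assumes
`refineOK … = true` (likewise `crudeOK`, and the Boolean tests `sidesB` / `crudeSidesB` imply the
real `WindowBox.Sides` / `LevelEntry.CrudeSides`).  Layer 3 (twin of `exitBox`, the row checker `rowsOK` with
`LevelTable.RowsValid` as its soundness statement, and the explicit table decided by
`decide +kernel`) is bp3 gen 13.
-/

noncomputable section

open Set

namespace Literature.Analysis.FluidPDE.FluidComputer

namespace DI

/-- [folklore] -/
theorem mem_zero (P : ℕ) : (pt 0).mem P (0 : ℝ) := by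
  have h := mem_pt P 0
  simpa using h

/-- [folklore] -/
theorem mem_one (P : ℕ) : (pt (2 ^ P)).mem P (1 : ℝ) := by
  have h := mem_pt P (2 ^ P)
  have h2 : ((2 ^ P : ℤ) : ℝ) / 2 ^ P = 1 := by
    push_cast; exact div_self (pow_ne_zero P two_ne_zero)
  rwa [h2] at h

/-- Quotient by a NEGATIVE divisor interval. [folklore] -/
def divNeg (P : ℕ) (I J : DI) : DI := (I.div P J.neg).neg

/-- [folklore] -/
theorem mem_divNeg {P : ℕ} {I J : DI} {x y : ℝ} (hJ : J.hi < 0) (hx : I.mem P x) (hy : J.mem P y) :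
    (divNeg P I J).mem P (x / y) := by
  have hJ' : 0 < J.neg.lo := by simp only [neg]; omega
  have h := mem_neg (mem_div hJ' hx (mem_neg hy))
  rw [div_neg, neg_neg] at h
  exact h

/-- Twin of Mathlib's `gronwallBound δ K ε t` on the branch `K < 0` (with `K t ≤ 0`):
`δ e^{Kt} + (ε/K)(e^{Kt} - 1)`. [folklore] -/
def gronwallI (P n : ℕ) (δ K ε t : DI) : DI :=
  (δ.mul P (expNonpos P n (K.mul P t))).add
    ((divNeg P ε K).mul P ((expNonpos P n (K.mul P t)).sub (pt (2 ^ P))))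

/-- [folklore] -/
theorem mem_gronwallI {P n : ℕ} (hn : 0 < n) {δI KI εI tI : DI} {δ K ε t : ℝ}
    (hK0 : KI.hi < 0) (hKt : (KI.mul P tI).hi ≤ 0)
    (hδ : δI.mem P δ) (hK : KI.mem P K) (hε : εI.mem P ε) (ht : tI.mem P t) :
    (gronwallI P n δI KI εI tI).mem P (gronwallBound δ K ε t) := by
  have h2P : (0 : ℝ) < 2 ^ P := pow_pos two_pos P
  have hKneg : K < 0 := by
    have : (KI.hi : ℝ) < 0 := by exact_mod_cast hK0
    nlinarith [hK.2]
  rw [gronwallBound, if_neg hKneg.ne]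
  have hE := mem_expNonpos hn hKt (mem_mul hK ht)
  exact mem_add (mem_mul hδ hE) (mem_mul (mem_divNeg hK0 hε hK) (mem_sub hE (mem_one P)))

end DI

/-! ### Interval versions of the data records -/

/-- Interval gate data. [folklore] -/
structure GateDataI where
  /-- couplings and forcing size, as intervals -/
  ε : DI
  σ : DI
  ν : DI
  μ : DI
  r : DI
  κ : DI
  δ : DI

/-- [folklore] -/
structure GateDataI.Mem (P : ℕ) (GI : GateDataI) (G : GateData) : Prop where
  ε : GI.ε.mem P G.ε
  σ : GI.σ.mem P G.σ
  ν : GI.ν.mem P G.ν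
  μ : GI.μ.mem P G.μ
  r : GI.r.mem P G.r
  κ : GI.κ.mem P G.κ
  δ : GI.δ.mem P G.δ

/-- Interval entry box. [folklore] -/
structure LevelEntryI where
  /-- the ten entry-box ends, as intervals -/
  al : DI
  ah : DI
  bl : DI
  bh : DI
  wl : DI
  wh : DI
  zl : DI
  zh : DI
  El : DI
  Eh : DI

/-- [folklore] -/
structure LevelEntryI.Mem (P : ℕ) (BI : LevelEntryI) (B : LevelEntry) : Prop where
  al : BI.al.mem P B.al
  ah : BI.ah.mem P B.ah
  bl : BI.bl.mem P B.bl
  bh : BI.bh.mem P B.bh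
  wl : BI.wl.mem P B.wl
  wh : BI.wh.mem P B.wh
  zl : BI.zl.mem P B.zl
  zh : BI.zh.mem P B.zh
  El : BI.El.mem P B.El
  Eh : BI.Eh.mem P B.Eh

/-- Interval window box. [folklore] -/
structure WindowBoxI where
  /-- the twelve window-box ends, as intervals -/
  Aℓ : DI
  Ah : DI
  Bℓ : DI
  Bh : DI
  cℓ : DI
  ch : DI
  Dℓ : DI
  Dh : DI
  Zℓ : DI
  Zh : DI
  Wℓ : DI
  Wh : DI

/-- [folklore] -/
structure WindowBoxI.Mem (P : ℕ) (SI : WindowBoxI) (S : WindowBox) : Prop where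
  Aℓ : SI.Aℓ.mem P S.Aℓ
  Ah : SI.Ah.mem P S.Ah
  Bℓ : SI.Bℓ.mem P S.Bℓ
  Bh : SI.Bh.mem P S.Bh
  cℓ : SI.cℓ.mem P S.cℓ
  ch : SI.ch.mem P S.ch
  Dℓ : SI.Dℓ.mem P S.Dℓ
  Dh : SI.Dh.mem P S.Dh
  Zℓ : SI.Zℓ.mem P S.Zℓ
  Zh : SI.Zh.mem P S.Zh
  Wℓ : SI.Wℓ.mem P S.Wℓ
  Wh : SI.Wh.mem P S.Wh

namespace WindowBoxI

variable (P n : ℕ) (GI : GateDataI) (SI : WindowBoxI)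

/-- twin of `WindowBox.gℓ` [folklore] -/
def gℓ : DI := (GI.ν.mul P SI.Bℓ).sub (GI.μ.mul P SI.Ah)
/-- twin of `WindowBox.gh` [folklore] -/
def gh : DI := (GI.ν.mul P SI.Bh).sub (GI.μ.mul P SI.Aℓ)
/-- twin of `WindowBox.ρℓ` [folklore] -/
def ρℓ : DI := ((GI.σ.mul P (SI.Aℓ.sq P)).add ((SI.gℓ P GI).mul P SI.cℓ)).sub GI.δ
/-- twin of `WindowBox.ρh` [folklore] -/
def ρh : DI := ((GI.σ.mul P (SI.Ah.sq P)).add ((SI.gh P GI).mul P SI.ch)).add GI.δ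
/-- twin of `WindowBox.Ψℓ` [folklore] -/
def Ψℓ : DI :=
  (((((((GI.κ.sq P).mul P (SI.Dℓ.cube P)).sub (((GI.r.mul P GI.σ)).mul P (SI.Ah.cube P))).sub
    ((((GI.r.mul P (SI.gh P GI))).mul P SI.Ah).mul P SI.ch)).add
    ((((GI.r.mul P GI.ε).mul P SI.Aℓ).mul P SI.Bℓ).mul P SI.cℓ)).add
    (((GI.r.mul P GI.σ).mul P SI.Aℓ).mul P (SI.cℓ.sq P))).sub
    ((GI.r.mul P GI.μ).mul P (SI.ch.cube P))).add
    (((GI.r.sq P).mul P (SI.cℓ.sq P)).mul P SI.Dℓ)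
/-- twin of `WindowBox.Ψh` [folklore] -/
def Ψh : DI :=
  (((((((GI.κ.sq P).mul P (SI.Dh.cube P)).sub (((GI.r.mul P GI.σ)).mul P (SI.Aℓ.cube P))).sub
    ((((GI.r.mul P (SI.gℓ P GI))).mul P SI.Aℓ).mul P SI.cℓ)).add
    ((((GI.r.mul P GI.ε).mul P SI.Ah).mul P SI.Bh).mul P SI.ch)).add
    (((GI.r.mul P GI.σ).mul P SI.Ah).mul P (SI.ch.sq P))).sub
    ((GI.r.mul P GI.μ).mul P (SI.cℓ.cube P))).add
    (((GI.r.sq P).mul P (SI.ch.sq P)).mul P SI.Dh)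
/-- twin of `WindowBox.frc` [folklore] -/
def frc : DI :=
  GI.δ.mul P (((GI.κ.mul P SI.Zh).add (GI.κ.mul P SI.Dh)).add (GI.r.mul P (SI.Ah.add SI.ch)))
/-- twin of `WindowBox.skew` [folklore] -/
def skew : DI := (GI.κ.mul P (SI.Zh.sub SI.Zℓ)).mul P (SI.Wℓ.neg.max (DI.pt 0))
/-- twin of `WindowBox.sℓ` [folklore] -/
def sℓ : DI := ((SI.Ψℓ P GI).sub (SI.frc P GI)).sub (SI.skew P GI)
/-- twin of `WindowBox.sh` [folklore] -/
def sh : DI := ((SI.Ψh P GI).add (SI.frc P GI)).add (SI.skew P GI)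
/-- twin of `WindowBox.Λh` [folklore] -/
def Λh : DI :=
  ((GI.ε.mul P SI.Bh).add (GI.σ.mul P SI.ch)).add
    (((GI.r.sq P).mul P (SI.ch.sq P)).div P (GI.κ.mul P SI.Zℓ))
/-- twin of `WindowBox.Λℓ` [folklore] -/
def Λℓ : DI :=
  ((GI.ε.mul P SI.Bℓ).add (GI.σ.mul P SI.cℓ)).add
    (((GI.r.sq P).mul P (SI.cℓ.sq P)).div P (GI.κ.mul P SI.Zh))
/-- twin of `WindowBox.mℓ` [folklore] -/
def mℓ : DI :=
  ((GI.μ.mul P (SI.cℓ.sq P)).sub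
    ((((GI.r.mul P SI.ch).mul P (SI.Wh.max (DI.pt 0))).div P (GI.κ.mul P SI.Zℓ)).sub
      (((GI.r.mul P SI.cℓ).mul P (SI.Wh.neg.max (DI.pt 0))).div P (GI.κ.mul P SI.Zh)))).sub GI.δ
/-- twin of `WindowBox.mh` [folklore] -/
def mh : DI :=
  ((GI.μ.mul P (SI.ch.sq P)).add
    ((((GI.r.mul P SI.ch).mul P (SI.Wℓ.neg.max (DI.pt 0))).div P (GI.κ.mul P SI.Zℓ)).sub
      (((GI.r.mul P SI.cℓ).mul P (SI.Wℓ.max (DI.pt 0))).div P (GI.κ.mul P SI.Zh)))).add GI.δ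
/-- twin of `WindowBox.βℓ` [folklore] -/
def βℓ : DI := ((GI.ε.mul P (SI.Aℓ.sq P)).sub (GI.ν.mul P (SI.ch.sq P))).sub GI.δ
/-- twin of `WindowBox.βh` [folklore] -/
def βh : DI := ((GI.ε.mul P (SI.Ah.sq P)).sub (GI.ν.mul P (SI.cℓ.sq P))).add GI.δ
/-- twin of `WindowBox.ζℓ` [folklore] -/
def ζℓ : DI := (GI.κ.mul P (SI.Dℓ.sq P)).sub GI.δ
/-- twin of `WindowBox.ζh` [folklore] -/
def ζh : DI := (GI.κ.mul P (SI.Dh.sq P)).add GI.δ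
/-- twin of `WindowBox.aFloor` [folklore] -/
def aFloor (al t : DI) : DI := (DI.gronwallI P n al.neg (SI.Λh P GI).neg (SI.mℓ P GI).neg t).neg
/-- twin of `WindowBox.aCeil` [folklore] -/
def aCeil (ah t : DI) : DI := DI.gronwallI P n ah (SI.Λℓ P GI).neg (SI.mh P GI) t
/-- twin of `WindowBox.wFloor` [folklore] -/
def wFloor (wl t : DI) : DI :=
  (DI.gronwallI P n wl.neg (GI.κ.mul P SI.Zh).neg (SI.sℓ P GI).neg t).neg
/-- twin of `WindowBox.wCeil` [folklore] -/
def wCeil (wh t : DI) : DI := DI.gronwallI P n wh (GI.κ.mul P SI.Zℓ).neg (SI.sh P GI) t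

/-- twin of `WindowBox.refine` [folklore] -/
def refine (BI : LevelEntryI) (hI CI C'I : DI) : WindowBoxI :=
  let z : DI := DI.pt 0
  let Aℓ' := SI.Aℓ.max ((SI.aFloor P n GI BI.al z).min (SI.aFloor P n GI BI.al hI))
  let Ah' := SI.Ah.min ((SI.aCeil P n GI BI.ah z).max (SI.aCeil P n GI BI.ah hI))
  let Bℓ' := SI.Bℓ.max ((BI.bl.add ((SI.βℓ P GI).mul P z)).min (BI.bl.add ((SI.βℓ P GI).mul P hI)))
  let Bh' := SI.Bh.min ((BI.bh.add ((SI.βh P GI).mul P z)).max (BI.bh.add ((SI.βh P GI).mul P hI)))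
  let cℓ' := SI.cℓ.max CI
  let Zℓ' := SI.Zℓ.max ((BI.zl.add ((SI.ζℓ P GI).mul P z)).min (BI.zl.add ((SI.ζℓ P GI).mul P hI)))
  let Zh' := SI.Zh.min ((BI.zh.add ((SI.ζh P GI).mul P z)).max (BI.zh.add ((SI.ζh P GI).mul P hI)))
  let Wℓ' := SI.Wℓ.max ((SI.wFloor P n GI BI.wl z).min (SI.wFloor P n GI BI.wl hI))
  let Wh' := SI.Wh.min ((SI.wCeil P n GI BI.wh z).max (SI.wCeil P n GI BI.wh hI))
  { Aℓ := Aℓ', Ah := Ah', Bℓ := Bℓ', Bh := Bh', cℓ := cℓ', ch := C'I,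
    Dℓ := SI.Dℓ.max (((Wℓ'.add ((GI.r.mul P cℓ').mul P Aℓ'))).div P (GI.κ.mul P Zh')),
    Dh := SI.Dh.min (((Wh'.add ((GI.r.mul P C'I).mul P Ah'))).div P (GI.κ.mul P Zℓ')),
    Zℓ := Zℓ', Zh := Zh', Wℓ := Wℓ', Wh := Wh' }

/-- The runtime side conditions of `refine`: positive divisors, positive Grönwall rates,
nonpositive exponents. [folklore] -/
def refineOK (BI : LevelEntryI) (hI CI C'I : DI) : Bool :=
  let R := SI.refine P n GI BI hI CI C'I
  DI.posB (GI.κ.mul P SI.Zℓ) && DI.posB (GI.κ.mul P SI.Zh) &&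
  DI.posB (SI.Λh P GI) && DI.posB (SI.Λℓ P GI) &&
  decide (((SI.Λh P GI).neg.mul P (DI.pt 0)).hi ≤ 0) && decide (((SI.Λh P GI).neg.mul P hI).hi ≤ 0) &&
  decide (((SI.Λℓ P GI).neg.mul P (DI.pt 0)).hi ≤ 0) && decide (((SI.Λℓ P GI).neg.mul P hI).hi ≤ 0) &&
  decide (((GI.κ.mul P SI.Zh).neg.mul P (DI.pt 0)).hi ≤ 0) &&
  decide (((GI.κ.mul P SI.Zh).neg.mul P hI).hi ≤ 0) &&
  decide (((GI.κ.mul P SI.Zℓ).neg.mul P (DI.pt 0)).hi ≤ 0) &&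
  decide (((GI.κ.mul P SI.Zℓ).neg.mul P hI).hi ≤ 0) &&
  DI.posB (GI.κ.mul P R.Zh) && DI.posB (GI.κ.mul P R.Zℓ)

end WindowBoxI

/-! ### The crude pass-1 box and the side conditions -/

namespace LevelEntryI

variable (P n : ℕ) (GI : GateDataI) (BI : LevelEntryI) (RbI hI CI C'I : DI)

/-- twin of `LevelEntry.crudeBox` [folklore] -/
def crudeBox : WindowBoxI :=
  let dl0 := (BI.wl.add ((GI.r.mul P CI).mul P BI.al)).div P (GI.κ.mul P BI.zh)
  let dh0 := (BI.wh.add ((GI.r.mul P CI).mul P BI.ah)).div P (GI.κ.mul P BI.zl)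
  let A1h := BI.ah.add ((((GI.ε.mul P (RbI.sq P)).add (GI.μ.mul P (C'I.sq P))).add GI.δ).mul P hI)
  let D1h := dh0.add ((((GI.r.mul P A1h).mul P C'I).add GI.δ).mul P hI)
  let A1l := BI.al.sub (((((GI.ε.mul P (RbI.sq P)).add ((GI.σ.mul P RbI).mul P C'I)).add
    ((GI.r.mul P C'I).mul P D1h)).add GI.δ).mul P hI)
  let B1l := BI.bl.sub (((GI.ν.mul P (C'I.sq P)).add GI.δ).mul P hI)
  let B1h := BI.bh.add (((GI.ε.mul P (RbI.sq P)).add GI.δ).mul P hI)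
  let c1l := (CI.mul P ((DI.pt (2 ^ P)).sub (((GI.ν.add GI.μ).mul P RbI).mul P hI))).sub
    (GI.δ.mul P hI)
  let D1l := (dl0.mul P (DI.expNonpos P n (((GI.κ.mul P RbI).neg).mul P hI))).sub (GI.δ.mul P hI)
  let Z1l := BI.zl.sub (GI.δ.mul P hI)
  let Z1h := BI.zh.add (((GI.κ.mul P (D1h.sq P)).add GI.δ).mul P hI)
  { Aℓ := A1l, Ah := A1h, Bℓ := B1l, Bh := B1h, cℓ := c1l, ch := C'I, Dℓ := D1l, Dh := D1h,
    Zℓ := Z1l, Zh := Z1h,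
    Wℓ := ((GI.κ.mul P D1l).mul P Z1l).sub ((GI.r.mul P C'I).mul P A1h),
    Wh := ((GI.κ.mul P D1h).mul P Z1h).sub ((GI.r.mul P c1l).mul P A1l) }

/-- Runtime conditions of the crude box: positive divisors `κ·zh`, `κ·zl`, nonpositive exponent.
[folklore] -/
def crudeOK : Bool :=
  DI.posB (GI.κ.mul P BI.zh) && DI.posB (GI.κ.mul P BI.zl) &&
    decide ((((GI.κ.mul P RbI).neg).mul P hI).hi ≤ 0)

/-- Boolean test implying `LevelEntry.CrudeSides`. [folklore] -/
def crudeSidesB : Bool :=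
  let S := BI.crudeBox P n GI RbI hI CI C'I
  DI.posB CI && DI.leB CI C'I && DI.posB BI.al && DI.posB BI.zl &&
    DI.nonnegB (BI.wl.add ((GI.r.mul P CI).mul P BI.al)) &&
    DI.posB S.Aℓ && DI.posB S.Bℓ && DI.posB S.cℓ && DI.posB S.Dℓ && DI.posB S.Zℓ

end LevelEntryI

namespace WindowBoxI

/-- Boolean test implying `WindowBox.Sides`. [folklore] -/
def sidesB (P : ℕ) (GI : GateDataI) (SI : WindowBoxI) : Bool :=
  DI.nonnegB SI.Aℓ && DI.nonnegB SI.Bℓ && DI.nonnegB SI.cℓ && DI.nonnegB SI.Dℓ && DI.posB SI.Zℓ &&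
    DI.nonnegB ((GI.ν.mul P SI.Bℓ).sub (GI.μ.mul P SI.Ah)) &&
    DI.nonnegB (((GI.σ.mul P (SI.Aℓ.sq P)).add
      (((GI.ν.mul P SI.Bℓ).sub (GI.μ.mul P SI.Ah)).mul P SI.cℓ)).sub GI.δ)

end WindowBoxI

/-! ### Soundness -/

namespace WindowBoxI.Mem

open DI

variable {P n : ℕ} {GI : GateDataI} {G : GateData} {SI : WindowBoxI} {S : WindowBox}

/-- [folklore] -/
theorem gℓ (hG : GI.Mem P G) (hS : SI.Mem P S) : (SI.gℓ P GI).mem P (S.gℓ G) :=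
  mem_sub (mem_mul hG.ν hS.Bℓ) (mem_mul hG.μ hS.Ah)

/-- [folklore] -/
theorem gh (hG : GI.Mem P G) (hS : SI.Mem P S) : (SI.gh P GI).mem P (S.gh G) :=
  mem_sub (mem_mul hG.ν hS.Bh) (mem_mul hG.μ hS.Aℓ)

/-- [folklore] -/
theorem ρℓ (hG : GI.Mem P G) (hS : SI.Mem P S) : (SI.ρℓ P GI).mem P (S.ρℓ G) :=
  mem_sub (mem_add (mem_mul hG.σ (mem_sq hS.Aℓ)) (mem_mul (gℓ hG hS) hS.cℓ)) hG.δ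

/-- [folklore] -/
theorem ρh (hG : GI.Mem P G) (hS : SI.Mem P S) : (SI.ρh P GI).mem P (S.ρh G) :=
  mem_add (mem_add (mem_mul hG.σ (mem_sq hS.Ah)) (mem_mul (gh hG hS) hS.ch)) hG.δ

/-- [folklore] -/
theorem Ψℓ (hG : GI.Mem P G) (hS : SI.Mem P S) : (SI.Ψℓ P GI).mem P (S.Ψℓ G) :=
  mem_add (mem_sub (mem_add (mem_add (mem_sub (mem_sub
    (mem_mul (mem_sq hG.κ) (mem_cube hS.Dℓ))
    (mem_mul (mem_mul hG.r hG.σ) (mem_cube hS.Ah)))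
    (mem_mul (mem_mul (mem_mul hG.r (gh hG hS)) hS.Ah) hS.ch))
    (mem_mul (mem_mul (mem_mul (mem_mul hG.r hG.ε) hS.Aℓ) hS.Bℓ) hS.cℓ))
    (mem_mul (mem_mul (mem_mul hG.r hG.σ) hS.Aℓ) (mem_sq hS.cℓ)))
    (mem_mul (mem_mul hG.r hG.μ) (mem_cube hS.ch)))
    (mem_mul (mem_mul (mem_sq hG.r) (mem_sq hS.cℓ)) hS.Dℓ)

/-- [folklore] -/
theorem Ψh (hG : GI.Mem P G) (hS : SI.Mem P S) : (SI.Ψh P GI).mem P (S.Ψh G) :=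
  mem_add (mem_sub (mem_add (mem_add (mem_sub (mem_sub
    (mem_mul (mem_sq hG.κ) (mem_cube hS.Dh))
    (mem_mul (mem_mul hG.r hG.σ) (mem_cube hS.Aℓ)))
    (mem_mul (mem_mul (mem_mul hG.r (gℓ hG hS)) hS.Aℓ) hS.cℓ))
    (mem_mul (mem_mul (mem_mul (mem_mul hG.r hG.ε) hS.Ah) hS.Bh) hS.ch))
    (mem_mul (mem_mul (mem_mul hG.r hG.σ) hS.Ah) (mem_sq hS.ch)))
    (mem_mul (mem_mul hG.r hG.μ) (mem_cube hS.cℓ)))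
    (mem_mul (mem_mul (mem_sq hG.r) (mem_sq hS.ch)) hS.Dh)

/-- [folklore] -/
theorem frc (hG : GI.Mem P G) (hS : SI.Mem P S) : (SI.frc P GI).mem P (S.frc G) :=
  mem_mul hG.δ (mem_add (mem_add (mem_mul hG.κ hS.Zh) (mem_mul hG.κ hS.Dh))
    (mem_mul hG.r (mem_add hS.Ah hS.ch)))

/-- [folklore] -/
theorem skew (hG : GI.Mem P G) (hS : SI.Mem P S) : (SI.skew P GI).mem P (S.skew G) :=
  mem_mul (mem_mul hG.κ (mem_sub hS.Zh hS.Zℓ)) (mem_max (mem_neg hS.Wℓ) (mem_zero P))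

/-- [folklore] -/
theorem sℓ (hG : GI.Mem P G) (hS : SI.Mem P S) : (SI.sℓ P GI).mem P (S.sℓ G) :=
  mem_sub (mem_sub (Ψℓ hG hS) (frc hG hS)) (skew hG hS)

/-- [folklore] -/
theorem sh (hG : GI.Mem P G) (hS : SI.Mem P S) : (SI.sh P GI).mem P (S.sh G) :=
  mem_add (mem_add (Ψh hG hS) (frc hG hS)) (skew hG hS)

/-- [folklore] -/
theorem Λh (hG : GI.Mem P G) (hS : SI.Mem P S) (h1 : DI.posB (GI.κ.mul P SI.Zℓ) = true) :
    (SI.Λh P GI).mem P (S.Λh G) :=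
  mem_add (mem_add (mem_mul hG.ε hS.Bh) (mem_mul hG.σ hS.ch))
    (mem_div (of_decide_eq_true h1) (mem_mul (mem_sq hG.r) (mem_sq hS.ch)) (mem_mul hG.κ hS.Zℓ))

/-- [folklore] -/
theorem Λℓ (hG : GI.Mem P G) (hS : SI.Mem P S) (h2 : DI.posB (GI.κ.mul P SI.Zh) = true) :
    (SI.Λℓ P GI).mem P (S.Λℓ G) :=
  mem_add (mem_add (mem_mul hG.ε hS.Bℓ) (mem_mul hG.σ hS.cℓ))
    (mem_div (of_decide_eq_true h2) (mem_mul (mem_sq hG.r) (mem_sq hS.cℓ)) (mem_mul hG.κ hS.Zh))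

/-- [folklore] -/
theorem mℓ (hG : GI.Mem P G) (hS : SI.Mem P S) (h1 : DI.posB (GI.κ.mul P SI.Zℓ) = true)
    (h2 : DI.posB (GI.κ.mul P SI.Zh) = true) : (SI.mℓ P GI).mem P (S.mℓ G) :=
  mem_sub (mem_sub (mem_mul hG.μ (mem_sq hS.cℓ))
    (mem_sub
      (mem_div (of_decide_eq_true h1) (mem_mul (mem_mul hG.r hS.ch) (mem_max hS.Wh (mem_zero P)))
        (mem_mul hG.κ hS.Zℓ))
      (mem_div (of_decide_eq_true h2) (mem_mul (mem_mul hG.r hS.cℓ)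
        (mem_max (mem_neg hS.Wh) (mem_zero P))) (mem_mul hG.κ hS.Zh)))) hG.δ

/-- [folklore] -/
theorem mh (hG : GI.Mem P G) (hS : SI.Mem P S) (h1 : DI.posB (GI.κ.mul P SI.Zℓ) = true)
    (h2 : DI.posB (GI.κ.mul P SI.Zh) = true) : (SI.mh P GI).mem P (S.mh G) :=
  mem_add (mem_add (mem_mul hG.μ (mem_sq hS.ch))
    (mem_sub
      (mem_div (of_decide_eq_true h1) (mem_mul (mem_mul hG.r hS.ch)
        (mem_max (mem_neg hS.Wℓ) (mem_zero P))) (mem_mul hG.κ hS.Zℓ))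
      (mem_div (of_decide_eq_true h2) (mem_mul (mem_mul hG.r hS.cℓ) (mem_max hS.Wℓ (mem_zero P)))
        (mem_mul hG.κ hS.Zh)))) hG.δ

/-- [folklore] -/
theorem βℓ (hG : GI.Mem P G) (hS : SI.Mem P S) : (SI.βℓ P GI).mem P (S.βℓ G) :=
  mem_sub (mem_sub (mem_mul hG.ε (mem_sq hS.Aℓ)) (mem_mul hG.ν (mem_sq hS.ch))) hG.δ

/-- [folklore] -/
theorem βh (hG : GI.Mem P G) (hS : SI.Mem P S) : (SI.βh P GI).mem P (S.βh G) :=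
  mem_add (mem_sub (mem_mul hG.ε (mem_sq hS.Ah)) (mem_mul hG.ν (mem_sq hS.cℓ))) hG.δ

/-- [folklore] -/
theorem ζℓ (hG : GI.Mem P G) (hS : SI.Mem P S) : (SI.ζℓ P GI).mem P (S.ζℓ G) :=
  mem_sub (mem_mul hG.κ (mem_sq hS.Dℓ)) hG.δ

/-- [folklore] -/
theorem ζh (hG : GI.Mem P G) (hS : SI.Mem P S) : (SI.ζh P GI).mem P (S.ζh G) :=
  mem_add (mem_mul hG.κ (mem_sq hS.Dh)) hG.δ

/-- [folklore] -/
theorem posB_neg_neg {I : DI} (h : DI.posB I = true) : I.neg.hi < 0 := by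
  have := of_decide_eq_true h; simp only [DI.neg]; omega

/-- [folklore] -/
theorem aFloor (hn : 0 < n) (hG : GI.Mem P G) (hS : SI.Mem P S)
    (h1 : DI.posB (GI.κ.mul P SI.Zℓ) = true) (h2 : DI.posB (GI.κ.mul P SI.Zh) = true)
    (h3 : DI.posB (SI.Λh P GI) = true) {alI tI : DI} {al t : ℝ}
    (h4 : (((SI.Λh P GI).neg).mul P tI).hi ≤ 0) (hal : alI.mem P al) (ht : tI.mem P t) :
    (SI.aFloor P n GI alI tI).mem P (S.aFloor G al t) :=
  mem_neg (mem_gronwallI hn (posB_neg_neg h3) h4 (mem_neg hal) (mem_neg (Λh hG hS h1))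
    (mem_neg (mℓ hG hS h1 h2)) ht)

/-- [folklore] -/
theorem aCeil (hn : 0 < n) (hG : GI.Mem P G) (hS : SI.Mem P S)
    (h1 : DI.posB (GI.κ.mul P SI.Zℓ) = true) (h2 : DI.posB (GI.κ.mul P SI.Zh) = true)
    (h3 : DI.posB (SI.Λℓ P GI) = true) {ahI tI : DI} {ah t : ℝ}
    (h4 : (((SI.Λℓ P GI).neg).mul P tI).hi ≤ 0) (hah : ahI.mem P ah) (ht : tI.mem P t) :
    (SI.aCeil P n GI ahI tI).mem P (S.aCeil G ah t) :=
  mem_gronwallI hn (posB_neg_neg h3) h4 hah (mem_neg (Λℓ hG hS h2)) (mh hG hS h1 h2) ht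

/-- [folklore] -/
theorem wFloor (hn : 0 < n) (hG : GI.Mem P G) (hS : SI.Mem P S)
    (h2 : DI.posB (GI.κ.mul P SI.Zh) = true) {wlI tI : DI} {wl t : ℝ}
    (h4 : (((GI.κ.mul P SI.Zh).neg).mul P tI).hi ≤ 0) (hwl : wlI.mem P wl) (ht : tI.mem P t) :
    (SI.wFloor P n GI wlI tI).mem P (S.wFloor G wl t) :=
  mem_neg (mem_gronwallI hn (posB_neg_neg h2) h4 (mem_neg hwl) (mem_neg (mem_mul hG.κ hS.Zh))
    (mem_neg (sℓ hG hS)) ht)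

/-- [folklore] -/
theorem wCeil (hn : 0 < n) (hG : GI.Mem P G) (hS : SI.Mem P S)
    (h1 : DI.posB (GI.κ.mul P SI.Zℓ) = true) {whI tI : DI} {wh t : ℝ}
    (h4 : (((GI.κ.mul P SI.Zℓ).neg).mul P tI).hi ≤ 0) (hwh : whI.mem P wh) (ht : tI.mem P t) :
    (SI.wCeil P n GI whI tI).mem P (S.wCeil G wh t) :=
  mem_gronwallI hn (posB_neg_neg h1) h4 hwh (mem_neg (mem_mul hG.κ hS.Zℓ)) (sh hG hS) ht

/-- **Soundness of the refinement twin**: if the data lie in the intervals and the runtime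
conditions hold, every end of the real refined box lies in the corresponding computed interval.
[folklore] -/
theorem refine (hn : 0 < n) (hG : GI.Mem P G) (hS : SI.Mem P S) {BI : LevelEntryI}
    {B : LevelEntry} (hB : BI.Mem P B) {hI CI C'I : DI} {h C C' : ℝ} (hh : hI.mem P h)
    (hC : CI.mem P C) (hC' : C'I.mem P C')
    (hok : SI.refineOK P n GI BI hI CI C'I = true) :
    (SI.refine P n GI BI hI CI C'I).Mem P (S.refine G B h C C') := by
  simp only [WindowBoxI.refineOK, Bool.and_eq_true, decide_eq_true_eq] at hok
  obtain ⟨⟨⟨⟨⟨⟨⟨⟨⟨⟨⟨⟨⟨k1, k2⟩, k3⟩, k4⟩, k5⟩, k6⟩, k7⟩, k8⟩, k9⟩, k10⟩, k11⟩, k12⟩, k13⟩, k14⟩ :=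
    hok
  have hz := mem_zero P
  have hAℓ := mem_max hS.Aℓ (mem_min (aFloor hn hG hS k1 k2 k3 k5 hB.al hz)
    (aFloor hn hG hS k1 k2 k3 k6 hB.al hh))
  have hAh := mem_min hS.Ah (mem_max (aCeil hn hG hS k1 k2 k4 k7 hB.ah hz)
    (aCeil hn hG hS k1 k2 k4 k8 hB.ah hh))
  have hBℓ := mem_max hS.Bℓ (mem_min (mem_add hB.bl (mem_mul (βℓ hG hS) hz))
    (mem_add hB.bl (mem_mul (βℓ hG hS) hh)))
  have hBh := mem_min hS.Bh (mem_max (mem_add hB.bh (mem_mul (βh hG hS) hz))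
    (mem_add hB.bh (mem_mul (βh hG hS) hh)))
  have hcℓ := mem_max hS.cℓ hC
  have hZℓ := mem_max hS.Zℓ (mem_min (mem_add hB.zl (mem_mul (ζℓ hG hS) hz))
    (mem_add hB.zl (mem_mul (ζℓ hG hS) hh)))
  have hZh := mem_min hS.Zh (mem_max (mem_add hB.zh (mem_mul (ζh hG hS) hz))
    (mem_add hB.zh (mem_mul (ζh hG hS) hh)))
  have hWℓ := mem_max hS.Wℓ (mem_min (wFloor hn hG hS k2 k9 hB.wl hz)
    (wFloor hn hG hS k2 k10 hB.wl hh))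
  have hWh := mem_min hS.Wh (mem_max (wCeil hn hG hS k1 k11 hB.wh hz)
    (wCeil hn hG hS k1 k12 hB.wh hh))
  exact
    { Aℓ := hAℓ, Ah := hAh, Bℓ := hBℓ, Bh := hBh, cℓ := hcℓ, ch := hC',
      Dℓ := mem_max hS.Dℓ (mem_div (of_decide_eq_true k13)
        (mem_add hWℓ (mem_mul (mem_mul hG.r hcℓ) hAℓ)) (mem_mul hG.κ hZh)),
      Dh := mem_min hS.Dh (mem_div (of_decide_eq_true k14)
        (mem_add hWh (mem_mul (mem_mul hG.r hC') hAh)) (mem_mul hG.κ hZℓ)),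
      Zℓ := hZℓ, Zh := hZh, Wℓ := hWℓ, Wh := hWh }

end WindowBoxI.Mem

/-! ### Soundness of the crude box and of the side tests -/

namespace LevelEntryI.Mem

open DI

variable {P n : ℕ} {GI : GateDataI} {G : GateData} {BI : LevelEntryI} {B : LevelEntry}
  {RbI hI CI C'I : DI} {Rb h C C' : ℝ}

/-- [folklore] -/
theorem crudeBox (hn : 0 < n) (hG : GI.Mem P G) (hB : BI.Mem P B) (hRb : RbI.mem P Rb)
    (hh : hI.mem P h) (hC : CI.mem P C) (hC' : C'I.mem P C')
    (hok : BI.crudeOK P GI RbI hI = true) :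
    (BI.crudeBox P n GI RbI hI CI C'I).Mem P (B.crudeBox G Rb h C C') := by
  simp only [LevelEntryI.crudeOK, Bool.and_eq_true, decide_eq_true_eq] at hok
  obtain ⟨⟨k1, k2⟩, k3⟩ := hok
  have hdl0 := mem_div (of_decide_eq_true k1) (mem_add hB.wl (mem_mul (mem_mul hG.r hC) hB.al))
    (mem_mul hG.κ hB.zh)
  have hdh0 := mem_div (of_decide_eq_true k2) (mem_add hB.wh (mem_mul (mem_mul hG.r hC) hB.ah))
    (mem_mul hG.κ hB.zl)
  have hA1h := mem_add hB.ah (mem_mul (mem_add (mem_add (mem_mul hG.ε (mem_sq hRb))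
    (mem_mul hG.μ (mem_sq hC'))) hG.δ) hh)
  have hD1h := mem_add hdh0 (mem_mul (mem_add (mem_mul (mem_mul hG.r hA1h) hC') hG.δ) hh)
  have hA1l := mem_sub hB.al (mem_mul (mem_add (mem_add (mem_add (mem_mul hG.ε (mem_sq hRb))
    (mem_mul (mem_mul hG.σ hRb) hC')) (mem_mul (mem_mul hG.r hC') hD1h)) hG.δ) hh)
  have hB1l := mem_sub hB.bl (mem_mul (mem_add (mem_mul hG.ν (mem_sq hC')) hG.δ) hh)
  have hB1h := mem_add hB.bh (mem_mul (mem_add (mem_mul hG.ε (mem_sq hRb)) hG.δ) hh)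
  have hc1l := mem_sub (mem_mul hC (mem_sub (mem_one P) (mem_mul (mem_mul (mem_add hG.ν hG.μ) hRb)
    hh))) (mem_mul hG.δ hh)
  have hD1l := mem_sub (mem_mul hdl0 (mem_expNonpos hn k3 (mem_mul (mem_neg (mem_mul hG.κ hRb)) hh)))
    (mem_mul hG.δ hh)
  have hZ1l := mem_sub hB.zl (mem_mul hG.δ hh)
  have hZ1h := mem_add hB.zh (mem_mul (mem_add (mem_mul hG.κ (mem_sq hD1h)) hG.δ) hh)
  exact
    { Aℓ := hA1l, Ah := hA1h, Bℓ := hB1l, Bh := hB1h, cℓ := hc1l, ch := hC', Dℓ := hD1l, Dh := hD1h,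
      Zℓ := hZ1l, Zh := hZ1h,
      Wℓ := mem_sub (mem_mul (mem_mul hG.κ hD1l) hZ1l) (mem_mul (mem_mul hG.r hC') hA1h),
      Wh := mem_sub (mem_mul (mem_mul hG.κ hD1h) hZ1h) (mem_mul (mem_mul hG.r hc1l) hA1l) }

/-- [folklore] -/
theorem crudeSides (hn : 0 < n) (hG : GI.Mem P G) (hB : BI.Mem P B) (hRb : RbI.mem P Rb)
    (hh : hI.mem P h) (hC : CI.mem P C) (hC' : C'I.mem P C')
    (hok : BI.crudeOK P GI RbI hI = true) (hs : BI.crudeSidesB P n GI RbI hI CI C'I = true) :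
    B.CrudeSides G Rb h C C' := by
  have hM := crudeBox hn hG hB hRb hh hC hC' hok
  simp only [LevelEntryI.crudeSidesB, Bool.and_eq_true] at hs
  obtain ⟨⟨⟨⟨⟨⟨⟨⟨⟨s1, s2⟩, s3⟩, s4⟩, s5⟩, s6⟩, s7⟩, s8⟩, s9⟩, s10⟩ := hs
  exact
    { hC := pos_of_posB s1 hC
      hCC' := le_of_leB s2 hC hC'
      hal := pos_of_posB s3 hB.al
      hzl := pos_of_posB s4 hB.zl
      hw0 := nonneg_of_nonnegB s5 (mem_add hB.wl (mem_mul (mem_mul hG.r hC) hB.al))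
      hA := pos_of_posB s6 hM.Aℓ
      hB := pos_of_posB s7 hM.Bℓ
      hc := pos_of_posB s8 hM.cℓ
      hD := pos_of_posB s9 hM.Dℓ
      hZ := pos_of_posB s10 hM.Zℓ }

end LevelEntryI.Mem

/-- [folklore] -/
theorem WindowBoxI.Mem.sides {P : ℕ} {GI : GateDataI} {G : GateData} {SI : WindowBoxI}
    {S : WindowBox} (hG : GI.Mem P G) (hS : SI.Mem P S) (hs : SI.sidesB P GI = true) :
    S.Sides G := by
  simp only [WindowBoxI.sidesB, Bool.and_eq_true] at hs
  obtain ⟨⟨⟨⟨⟨⟨s1, s2⟩, s3⟩, s4⟩, s5⟩, s6⟩, s7⟩ := hs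
  have hg := DI.mem_sub (DI.mem_mul hG.ν hS.Bℓ) (DI.mem_mul hG.μ hS.Ah)
  exact
    { hA := DI.nonneg_of_nonnegB s1 hS.Aℓ
      hB := DI.nonneg_of_nonnegB s2 hS.Bℓ
      hc := DI.nonneg_of_nonnegB s3 hS.cℓ
      hD := DI.nonneg_of_nonnegB s4 hS.Dℓ
      hZ := DI.pos_of_posB s5 hS.Zℓ
      hg := DI.nonneg_of_nonnegB s6 hg
      hρ := DI.nonneg_of_nonnegB s7 (DI.mem_sub (DI.mem_add (DI.mem_mul hG.σ (DI.mem_sq hS.Aℓ))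
        (DI.mem_mul hg hS.cℓ)) hG.δ) }

end Literature.Analysis.FluidPDE.FluidComputer

end
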